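import Literature.Computability.Cryptography.TreeSigDistinguisherRun
import Literature.Computability.Cryptography.TreeSigExtraction
import HarnessLib

/-!
# The authentication-tree scheme, IX: the planted node is used once

Topic `Literature/Computability/Cryptography`; the "obliviousness" step of Goldreich's proof of Prop. 6.4.15 /
6.4.17 for the one-time forger of the reduction, which plants its external verification key at one node `L₀` of
the emulated tree and answers the (at most one) signing request at that node with its own one-query oracle. We
compare the indexed attacks against the signers `OFunI pkN (sgN[L₀ ↦ sg]) ρ` for different node signers `sg` at
`L₀` (all other nodes, and all keys, fixed):

* an INTERNAL node `L₀` (`|L₀| < n`) only ever signs the pair of its children's keys, so the oracle, hence the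
  whole attack, depends on `sg` only through `sg (pairMsg pkN L₀)` (`OFunI_update_eq_of_short`,
  `run_update_eq_of_short`);
* a LEAF `L₀` (`|L₀| = n`) signs the documents of the queries whose leaf is `L₀`; when the leaves of the first `TA`
  queries are distinct (`NoColl`), this is at most the single query `i₀`, whose document is determined by the
  attack against ANY signer at `L₀` (the answers before round `i₀` do not involve `L₀`): the attack depends on `sg`
  only through `sg mStar` (`run_update_eq_of_leaf`), `mStar` the `i₀`-th query against the dummy signer;
* the generic run lemmas behind this: two indexed runs whose oracles differ at one round only on queries not
  asked there coincide (`IdxRun.runIdx_congr_single`), and transcript prefixes only depend on earlier rounds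
  (`IdxRun.queriesIdx_take_congr`).

All statements proved; no named facts; no probability.

## References

* O. Goldreich, *Foundations of Cryptography II*, CUP 2004, §6.4.2.2, proof of Prop. 6.4.15, Step 3 ("at most one
  signature need ever be produced with respect to each instance") and Step 4; Prop. 6.4.17.
-/

namespace Literature.Computability.Cryptography

open _root_.Computability Complexity Complexity.Brick Polynomial

/-! ### Generic: indexed runs differing at one round only on unasked queries; transcript prefixes -/

namespace IdxRun

open Literature.Computability.Complexity (OracleAlg)

variable {β : Type} (M : OracleAlg β)

/-- **Transcript prefixes.** If two indexed oracles agree below round `i₀`, the first `i₀ + 1` queries of the runs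
coincide (the `(i₀+1)`-st query only depends on the first `i₀` answers). [folklore] -/
theorem queriesIdxAux_take_congr {O O' : ℕ → List Bool → List Bool} (x : List Bool) (i₀ : ℕ)
    (h : ∀ i < i₀, ∀ q, O i q = O' i q) :
    ∀ (k : ℕ) (as : List (List Bool)), (M.queriesIdxAux O x k as).take (i₀ + 1 - as.length) = (M.queriesIdxAux O' x k as).take (i₀ + 1 - as.length)
  | 0, _ => rfl
  | k + 1, as => by
    rw [OracleAlg.queriesIdxAux, OracleAlg.queriesIdxAux]
    cases hs : M.step x as with
    | inr b => rfl
    | inl q =>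
      dsimp only
      by_cases hle : i₀ + 1 ≤ as.length
      · rw [Nat.sub_eq_zero_of_le hle, List.take_zero, List.take_zero]
      · obtain ⟨d, hd⟩ : ∃ d, i₀ + 1 - as.length = d + 1 := ⟨i₀ - as.length, by omega⟩
        rw [hd, List.take_succ_cons, List.take_succ_cons]
        by_cases hlt : as.length < i₀
        · rw [h _ hlt q]
          have := queriesIdxAux_take_congr x i₀ h k (as ++ [O' as.length q])
          rw [List.length_append, List.length_singleton, show i₀ + 1 - (as.length + 1) = d by omega] at this
          rw [this]
        · have hd0 : d = 0 := by omega
          subst hd0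
          rw [List.take_zero, List.take_zero]

/-- The `(i₀+1)`-prefix of the indexed transcript from the start. [folklore] -/
theorem queriesIdx_take_congr {O O' : ℕ → List Bool → List Bool} (k : ℕ) (x : List Bool) (i₀ : ℕ) (h : ∀ i < i₀, ∀ q, O i q = O' i q) :
    (M.queriesIdx O k x).take (i₀ + 1) = (M.queriesIdx O' k x).take (i₀ + 1) := by
  have := queriesIdxAux_take_congr M x i₀ h k []
  simpa [OracleAlg.queriesIdx] using this

/-- **Runs whose oracles agree on the queries actually asked coincide.** If, in every round `i` of the run against `O`,
the two indexed oracles agree on the query asked in that round, the runs and transcripts against `O` and `O'`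
coincide. [folklore] -/
theorem run_congr_on {O O' : ℕ → List Bool → List Bool} (x : List Bool) :
    ∀ (d : ℕ) (as pre : List (List Bool)) (k : ℕ), pre.length = as.length → as.length + d = k →
      M.queriesIdx O k x = pre ++ M.queriesIdxAux O x d as →
      (∀ (i : ℕ) (hi : i < (M.queriesIdx O k x).length), O i ((M.queriesIdx O k x)[i]) = O' i ((M.queriesIdx O k x)[i])) →
      M.runIdxAux O x d as = M.runIdxAux O' x d as ∧ M.queriesIdxAux O x d as = M.queriesIdxAux O' x d as
  | 0, _, _, _, _, _, _, _ => ⟨rfl, rfl⟩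
  | d + 1, as, pre, k, hpre, hk, hq, h => by
    rw [OracleAlg.runIdxAux, OracleAlg.runIdxAux]
    cases hs : M.step x as with
    | inr b =>
      refine ⟨rfl, ?_⟩
      rw [OracleAlg.queriesIdxAux, OracleAlg.queriesIdxAux, hs]
    | inl q =>
      have hqa : M.queriesIdxAux O x (d + 1) as = q :: M.queriesIdxAux O x d (as ++ [O as.length q]) := by
        rw [OracleAlg.queriesIdxAux, hs]
      have hqa' : M.queriesIdxAux O' x (d + 1) as = q :: M.queriesIdxAux O' x d (as ++ [O' as.length q]) := by
        rw [OracleAlg.queriesIdxAux, hs]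
      -- the query of round `|as|` is `q`
      have hlen : as.length < (M.queriesIdx O k x).length := by rw [hq, hqa]; simp; omega
      have hidx : (M.queriesIdx O k x)[as.length] = q := by
        rw [List.getElem_of_eq (hq.trans (by rw [hqa])) hlen, List.getElem_append_right (by omega)]
        simp [hpre]
      have hOq : O as.length q = O' as.length q := by have := h as.length hlen; rwa [hidx] at this
      dsimp only
      rw [hOq]
      have ih := run_congr_on x d (as ++ [O' as.length q]) (pre ++ [q]) k (by simp [hpre]) (by simp; omega)
        (by rw [hq, hqa, hOq]; simp) h
      exact ⟨ih.1, by rw [hqa, hqa', hOq, ih.2]⟩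

/-- `run_congr_on` from the start. [folklore] -/
theorem runIdx_congr_on {O O' : ℕ → List Bool → List Bool} (k : ℕ) (x : List Bool)
    (h : ∀ (i : ℕ) (hi : i < (M.queriesIdx O k x).length), O i ((M.queriesIdx O k x)[i]) = O' i ((M.queriesIdx O k x)[i])) :
    M.runIdx O k x = M.runIdx O' k x ∧ M.queriesIdx O k x = M.queriesIdx O' k x :=
  run_congr_on M x k [] [] k rfl (by simp) (by simp [OracleAlg.queriesIdx]) h

/-- **Runs differing at one round only on unasked queries.** If two indexed oracles agree at every round `≠ i₀` below
the budget, and at round `i₀` on the query the first run actually asks there (if any), the runs and transcripts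
coincide. [folklore] -/
theorem runIdx_congr_single {O O' : ℕ → List Bool → List Bool} (k : ℕ) (x : List Bool) (i₀ : ℕ)
    (h : ∀ i < k, i ≠ i₀ → ∀ q, O i q = O' i q)
    (h₀ : ∀ (hi : i₀ < (M.queriesIdx O k x).length), O i₀ ((M.queriesIdx O k x)[i₀]) = O' i₀ ((M.queriesIdx O k x)[i₀])) :
    M.runIdx O k x = M.runIdx O' k x ∧ M.queriesIdx O k x = M.queriesIdx O' k x := by
  refine runIdx_congr_on M k x fun i hi => ?_
  by_cases hi0 : i = i₀
  · subst hi0; exact h₀ hi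
  · exact h i (lt_of_lt_of_le hi (OracleAlg.length_queriesIdx_le _ _ _ _)) hi0 _

end IdxRun

namespace TreeSig

variable {P : Spec} {𝒜 : OracleAdversary (List Bool × List Bool)}

/-! ### The node signer at `L₀` replaced -/

/-- The pair of children keys of a node: the only message an internal node ever signs. [Goldreich 2004,
Construction 6.4.14 (step 3)] [folklore] -/
def pairMsg (pkN : List Bool → List Bool) (L : List Bool) : List Bool := boolPair (pkN (L ++ [false])) (pkN (L ++ [true]))

/-- `chainItems` only signs children pairs: it depends on the signer at `L₀` only through its value on
`pairMsg pkN L₀`. [folklore] -/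
theorem chainItems_update_congr (pkN : List Bool → List Bool) (sgN : List Bool → List Bool → List Bool) (L₀ : List Bool)
    {sg sg' : List Bool → List Bool} (h : sg (pairMsg pkN L₀) = sg' (pairMsg pkN L₀)) :
    ∀ pre σ : List Bool, chainItems pkN (Function.update sgN L₀ sg) pre σ = chainItems pkN (Function.update sgN L₀ sg') pre σ
  | _, [] => rfl
  | pre, b :: σ => by
    rw [chainItems, chainItems, chainItems_update_congr pkN sgN L₀ h (pre ++ [b]) σ]
    congr 3
    by_cases hp : pre = L₀
    · subst hp; rw [Function.update_self, Function.update_self]; exact h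
    · rw [Function.update_of_ne hp, Function.update_of_ne hp]

/-- **An internal planted node**: for `|L₀| < |σ|`, the node-interface signature at the leaf `σ` depends on the signer
at `L₀` only through its value on `pairMsg pkN L₀`. [Goldreich 2004, proof of Prop. 6.4.15, Step 3] [folklore] -/
theorem sigGI_update_eq_of_short (pkN : List Bool → List Bool) (sgN : List Bool → List Bool → List Bool) {L₀ σ : List Bool}
    (hσ : L₀.length < σ.length) {sg sg' : List Bool → List Bool} (h : sg (pairMsg pkN L₀) = sg' (pairMsg pkN L₀)) (α : List Bool) :
    sigGI pkN (Function.update sgN L₀ sg) α σ = sigGI pkN (Function.update sgN L₀ sg') α σ := by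
  have hne : ([] ++ σ) ≠ L₀ := by rintro rfl; simp at hσ
  rw [sigGI, sigGI, chainG, chainG, chainItems_update_congr pkN sgN L₀ h, Function.update_of_ne hne, Function.update_of_ne hne]

/-- **The attack with an internal planted node** depends on the signer at `L₀` only through `sg (pairMsg pkN L₀)`:
the oracles agree below the budget. [Goldreich 2004, proof of Prop. 6.4.15, Step 3] [folklore] -/
theorem OFunI_update_eq_of_short {n : ℕ} (pkN : List Bool → List Bool) (sgN : List Bool → List Bool → List Bool) {L₀ : List Bool}
    (hL : L₀.length < n) (ρ : List Bool) (hρ : TA P 𝒜 n * n ≤ ρ.length) {sg sg' : List Bool → List Bool}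
    (h : sg (pairMsg pkN L₀) = sg' (pairMsg pkN L₀)) : ∀ i < TA P 𝒜 n, ∀ α,
    OFunI n pkN (Function.update sgN L₀ sg) ρ i α = OFunI n pkN (Function.update sgN L₀ sg') ρ i α := by
  intro i hi α
  have hσ : (Yao.blk n i ρ).length = n := Yao.length_blk_of_le (le_trans (Nat.mul_le_mul_right n (Nat.succ_le_of_lt hi)) hρ)
  exact sigGI_update_eq_of_short pkN sgN (by rw [hσ]; exact hL) h α

/-- Hence the runs agree (internal planted node). [folklore] -/
theorem run_update_eq_of_short {n : ℕ} (pkN : List Bool → List Bool) (sgN : List Bool → List Bool → List Bool) {L₀ : List Bool}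
    (hL : L₀.length < n) (ρ : List Bool) (hρ : TA P 𝒜 n * n ≤ ρ.length) {sg sg' : List Bool → List Bool}
    (h : sg (pairMsg pkN L₀) = sg' (pairMsg pkN L₀)) (x : List Bool) :
    𝒜.alg.runIdx (OFunI n pkN (Function.update sgN L₀ sg) ρ) (TA P 𝒜 n) x = 𝒜.alg.runIdx (OFunI n pkN (Function.update sgN L₀ sg') ρ) (TA P 𝒜 n) x ∧
      𝒜.alg.queriesIdx (OFunI n pkN (Function.update sgN L₀ sg) ρ) (TA P 𝒜 n) x =
        𝒜.alg.queriesIdx (OFunI n pkN (Function.update sgN L₀ sg') ρ) (TA P 𝒜 n) x :=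
  ⟨runIdx_congr_lt _ _ _ (OFunI_update_eq_of_short pkN sgN hL ρ hρ h),
    queriesIdx_congr_lt _ _ _ (OFunI_update_eq_of_short pkN sgN hL ρ hρ h)⟩

/-! ### A planted leaf -/

/-- The leaves of the first `T` documents are pairwise distinct. [Goldreich 2004, proof of Prop. 6.4.17 (the leaves
`σ⁽ⁱ⁾` are uniformly distributed; collisions are the bad event)] [folklore] -/
def NoColl (n T : ℕ) (ρ : List Bool) : Prop := ∀ i j, i < j → j < T → Yao.blk n i ρ ≠ Yao.blk n j ρ

/-- Along a path, `chainItems` signs only at the proper prefixes `pre τ↾j`; if none of them is `L₀` the signer at `L₀` is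
not used. [folklore] -/
theorem chainItems_update_of_ne (pkN : List Bool → List Bool) (sgN : List Bool → List Bool → List Bool) (L₀ : List Bool)
    (sg sg' : List Bool → List Bool) : ∀ (pre τ : List Bool), (∀ j < τ.length, pre ++ τ.take j ≠ L₀) →
      chainItems pkN (Function.update sgN L₀ sg) pre τ = chainItems pkN (Function.update sgN L₀ sg') pre τ := by
  intro pre τ
  induction τ generalizing pre with
  | nil => intros; rfl
  | cons b τ ih =>
    intro hj
    have h0 : pre ≠ L₀ := by simpa using hj 0 (by simp)
    rw [chainItems, chainItems, Function.update_of_ne h0, Function.update_of_ne h0,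
      ih (pre ++ [b]) (fun j hj' => by
        have := hj (j + 1) (by simpa using hj'); simpa [List.take_succ_cons] using this)]

/-- At a leaf `σ ≠ L₀` of the same length, the signer at `L₀` is not used. [folklore] -/
theorem sigGI_update_eq_of_ne (pkN : List Bool → List Bool) (sgN : List Bool → List Bool → List Bool) {L₀ σ : List Bool}
    (hlen : L₀.length = σ.length) (hne : σ ≠ L₀) (sg sg' : List Bool → List Bool) (α : List Bool) :
    sigGI pkN (Function.update sgN L₀ sg) α σ = sigGI pkN (Function.update sgN L₀ sg') α σ := by
  have hne' : ([] ++ σ) ≠ L₀ := by simpa using hne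
  rw [sigGI, sigGI, chainG, chainG, Function.update_of_ne hne', Function.update_of_ne hne',
    chainItems_update_of_ne pkN sgN L₀ sg sg' [] σ (fun j hj h => by
      have := congrArg List.length h
      simp only [List.nil_append, List.length_take] at this
      omega)]

/-- At the leaf `L₀` itself, the signature depends on the signer at `L₀` only through its value on the document. [folklore] -/
theorem sigGI_update_congr_leaf (pkN : List Bool → List Bool) (sgN : List Bool → List Bool → List Bool) (L₀ : List Bool)
    {sg sg' : List Bool → List Bool} {α : List Bool} (h : sg α = sg' α) :
    sigGI pkN (Function.update sgN L₀ sg) α L₀ = sigGI pkN (Function.update sgN L₀ sg') α L₀ := by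
  rw [sigGI, sigGI, chainG, chainG, List.nil_append, Function.update_self, Function.update_self, h,
    chainItems_update_of_ne pkN sgN L₀ sg sg' [] L₀ (fun j hj h' => by
      have := congrArg List.length h'
      simp only [List.nil_append, List.length_take] at this
      omega)]

/-- At a leaf `σ` no prefix of which (itself included) is `L₀`, the signer at `L₀` is not used. [folklore] -/
theorem sigGI_update_eq_of_not_prefix (pkN : List Bool → List Bool) (sgN : List Bool → List Bool → List Bool) {L₀ σ : List Bool}
    (h : σ.take L₀.length ≠ L₀) (sg sg' : List Bool → List Bool) (α : List Bool) :
    sigGI pkN (Function.update sgN L₀ sg) α σ = sigGI pkN (Function.update sgN L₀ sg') α σ := by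
  have hall : ∀ j, σ.take j ≠ L₀ := by
    intro j hj
    apply h
    have hl : L₀.length = min j σ.length := by rw [← hj, List.length_take]
    rw [hl, ← List.take_take, List.take_length, hj]
  have hσ : σ ≠ L₀ := by simpa using hall σ.length
  have hne' : ([] ++ σ) ≠ L₀ := by simpa using hσ
  rw [sigGI, sigGI, chainG, chainG, Function.update_of_ne hne', Function.update_of_ne hne',
    chainItems_update_of_ne pkN sgN L₀ sg sg' [] σ (fun j _ => by simpa using hall j)]

open scoped Classical in
/-- The first of the `T` query rounds whose path passes through the node `L₀` (`T` if there is none): the round in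
which the planted node would sign. [Goldreich 2004, proof of Prop. 6.4.15, Step 3] [folklore] -/
noncomputable def firstUse (n T : ℕ) (ρ L₀ : List Bool) : ℕ :=
  if h : ∃ i, i < T ∧ (Yao.blk n i ρ).take L₀.length = L₀ then Nat.find h else T

/-- `firstUse ≤ T`. [folklore] -/
theorem firstUse_le (n T : ℕ) (ρ L₀ : List Bool) : firstUse n T ρ L₀ ≤ T := by
  classical
  unfold firstUse
  split_ifs with h
  · exact (Nat.find_spec h).1.le
  · exact le_rfl

/-- If `firstUse < T` its path passes through `L₀`. [folklore] -/
theorem take_blk_firstUse {n T : ℕ} {ρ L₀ : List Bool} (h : firstUse n T ρ L₀ < T) : (Yao.blk n (firstUse n T ρ L₀) ρ).take L₀.length = L₀ := by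
  classical
  unfold firstUse at h ⊢
  split_ifs at h ⊢ with h'
  · exact (Nat.find_spec h').2
  · exact absurd h (lt_irrefl _)

/-- Rounds before `firstUse` (below `T`) do not pass through `L₀`. [folklore] -/
theorem take_blk_ne_of_lt_firstUse {n T : ℕ} {ρ L₀ : List Bool} {i : ℕ} (hi : i < firstUse n T ρ L₀) (hiT : i < T) :
    (Yao.blk n i ρ).take L₀.length ≠ L₀ := by
  classical
  intro h
  unfold firstUse at hi
  split_ifs at hi with h'
  · exact Nat.find_min h' hi ⟨hiT, h⟩
  · exact h' ⟨i, hiT, h⟩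

/-- For a leaf-length `L₀`, the path of round `firstUse < T` has the leaf `L₀`. [folklore] -/
theorem blk_firstUse {n T : ℕ} {ρ L₀ : List Bool} (hL : L₀.length = n) (hlen : ∀ i < T, (Yao.blk n i ρ).length = n)
    (h : firstUse n T ρ L₀ < T) : Yao.blk n (firstUse n T ρ L₀) ρ = L₀ := by
  have := take_blk_firstUse h
  rwa [hL, List.take_of_length_le (hlen _ h).le] at this

/-- Under `NoColl`, for a leaf-length `L₀`, rounds other than `firstUse` (below `T`) have other leaves. [folklore] -/
theorem blk_ne_of_ne_firstUse {n T : ℕ} {ρ L₀ : List Bool} (hL : L₀.length = n) (hlen : ∀ i < T, (Yao.blk n i ρ).length = n)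
    (hnc : NoColl n T ρ) {i : ℕ} (hiT : i < T) (hi : i ≠ firstUse n T ρ L₀) : Yao.blk n i ρ ≠ L₀ := by
  intro h
  rcases lt_or_gt_of_ne hi with hlt | hgt
  · exact take_blk_ne_of_lt_firstUse hlt hiT (by rw [h, List.take_length])
  · have hf := blk_firstUse hL hlen (lt_trans hgt hiT)
    exact hnc _ _ hgt hiT (by rw [hf, h])

variable (P 𝒜)

/-- **The message the planted leaf must sign**: the `i₀`-th query (`i₀ = firstUse`) of the attack against the DUMMY
signer at `L₀` (answering `ε`), or `ε` if that query is not asked. [Goldreich 2004, proof of Prop. 6.4.15, Step 3] [folklore] -/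
noncomputable def mStarLeaf (n : ℕ) (pkN : List Bool → List Bool) (sgN : List Bool → List Bool → List Bool) (ρ L₀ x : List Bool) : List Bool :=
  (𝒜.alg.queriesIdx (OFunI n pkN (Function.update sgN L₀ fun _ => []) ρ) (TA P 𝒜 n) x).getD (firstUse n (TA P 𝒜 n) ρ L₀) []

variable {P 𝒜}

/-- **The attack with a planted leaf, under `NoColl`**, depends on the signer `sg` at `L₀` only through `sg mStarLeaf`:
runs and transcripts against `sgN[L₀ ↦ sg]` and `sgN[L₀ ↦ const (sg mStarLeaf)]` coincide.
[Goldreich 2004, proof of Prop. 6.4.15, Step 3; Prop. 6.4.17 (distinct leaves)] [folklore] -/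
theorem run_update_eq_of_leaf {n : ℕ} (pkN : List Bool → List Bool) (sgN : List Bool → List Bool → List Bool) {L₀ : List Bool}
    (hL : L₀.length = n) (ρ : List Bool) (hρ : TA P 𝒜 n * n ≤ ρ.length) (hnc : NoColl n (TA P 𝒜 n) ρ) (sg : List Bool → List Bool) (x : List Bool) :
    𝒜.alg.runIdx (OFunI n pkN (Function.update sgN L₀ sg) ρ) (TA P 𝒜 n) x =
        𝒜.alg.runIdx (OFunI n pkN (Function.update sgN L₀ fun _ => sg (mStarLeaf P 𝒜 n pkN sgN ρ L₀ x)) ρ) (TA P 𝒜 n) x ∧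
      𝒜.alg.queriesIdx (OFunI n pkN (Function.update sgN L₀ sg) ρ) (TA P 𝒜 n) x =
        𝒜.alg.queriesIdx (OFunI n pkN (Function.update sgN L₀ fun _ => sg (mStarLeaf P 𝒜 n pkN sgN ρ L₀ x)) ρ) (TA P 𝒜 n) x := by
  set T := TA P 𝒜 n with hT
  set i₀ := firstUse n T ρ L₀ with hi₀
  set O := OFunI n pkN (Function.update sgN L₀ sg) ρ with hO
  set O₀ := OFunI n pkN (Function.update sgN L₀ fun _ => []) ρ with hO₀
  have hlen : ∀ i < T, (Yao.blk n i ρ).length = n := fun i hi =>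
    Yao.length_blk_of_le (le_trans (Nat.mul_le_mul_right n (Nat.succ_le_of_lt hi)) hρ)
  -- oracles with any two signers at `L₀` agree in the rounds whose leaf is not `L₀`
  have hagree : ∀ (s₁ s₂ : List Bool → List Bool) (i : ℕ), i < T → Yao.blk n i ρ ≠ L₀ → ∀ α,
      OFunI n pkN (Function.update sgN L₀ s₁) ρ i α = OFunI n pkN (Function.update sgN L₀ s₂) ρ i α :=
    fun s₁ s₂ i hi hne α => sigGI_update_eq_of_ne pkN sgN (by rw [hL, hlen i hi]) hne s₁ s₂ α
  -- the first `i₀ + 1` queries are the same against `O` and against the dummy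
  have hpre : (𝒜.alg.queriesIdx O T x).take (i₀ + 1) = (𝒜.alg.queriesIdx O₀ T x).take (i₀ + 1) :=
    IdxRun.queriesIdx_take_congr 𝒜.alg T x i₀ fun i hi q =>
      hagree _ _ i (lt_of_lt_of_le hi (firstUse_le n T ρ L₀)) (fun h => take_blk_ne_of_lt_firstUse hi (lt_of_lt_of_le hi (firstUse_le n T ρ L₀))
        (by rw [h, List.take_length])) q
  refine IdxRun.runIdx_congr_single 𝒜.alg T x i₀ (fun i hi hne q => hagree _ _ i hi (blk_ne_of_ne_firstUse hL hlen hnc hi hne) q) fun hi => ?_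
  -- round `i₀`: the query asked is `mStarLeaf`
  have hi₀T : i₀ < T := lt_of_lt_of_le hi (OracleAlg.length_queriesIdx_le _ _ _ _)
  have hq : (𝒜.alg.queriesIdx O T x)[i₀] = mStarLeaf P 𝒜 n pkN sgN ρ L₀ x := by
    have h1 : ((𝒜.alg.queriesIdx O T x).take (i₀ + 1)).length = i₀ + 1 := by rw [List.length_take]; omega
    have hi' : i₀ < (𝒜.alg.queriesIdx O₀ T x).length := by
      have := congrArg List.length hpre
      rw [h1, List.length_take] at this
      omega
    rw [mStarLeaf, ← hT, ← hi₀, ← hO₀, List.getD_eq_getElem _ _ hi']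
    have e1 : (𝒜.alg.queriesIdx O T x)[i₀] = ((𝒜.alg.queriesIdx O T x).take (i₀ + 1))[i₀]'(by rw [h1]; omega) := by
      rw [List.getElem_take]
    have e2 : (𝒜.alg.queriesIdx O₀ T x)[i₀] = ((𝒜.alg.queriesIdx O₀ T x).take (i₀ + 1))[i₀]'(by rw [← hpre, h1]; omega) := by
      rw [List.getElem_take]
    rw [e1, e2]
    exact List.getElem_of_eq hpre _
  rw [hq, hO, OFunI, OFunI]
  rw [blk_firstUse hL hlen hi₀T]
  exact sigGI_update_congr_leaf pkN sgN L₀ rfl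

/-! ### The planted node, unified: the message it must sign; unused planted nodes -/

variable (P 𝒜)

/-- **The message the planted node `L₀` must sign**: the pair of its children's keys if it is internal, the document
of the first query through it if it is a leaf. [Goldreich 2004, proof of Prop. 6.4.15, Step 3] [folklore] -/
noncomputable def mStar (n : ℕ) (pkN : List Bool → List Bool) (sgN : List Bool → List Bool → List Bool) (ρ L₀ x : List Bool) : List Bool :=
  if L₀.length < n then pairMsg pkN L₀ else mStarLeaf P 𝒜 n pkN sgN ρ L₀ x

variable {P 𝒜}

/-- **The planted node is used once**: the attack against `sgN[L₀ ↦ sg]` coincides with the attack against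
`sgN[L₀ ↦ const (sg mStar)]` — for an internal `L₀` always, for a leaf `L₀` when the leaves are distinct.
[Goldreich 2004, proof of Prop. 6.4.15, Step 3; Prop. 6.4.17] [folklore] -/
theorem run_update_eq {n : ℕ} (pkN : List Bool → List Bool) (sgN : List Bool → List Bool → List Bool) {L₀ : List Bool} (ρ : List Bool)
    (hL : L₀.length < n ∨ (L₀.length = n ∧ NoColl n (TA P 𝒜 n) ρ)) (hρ : TA P 𝒜 n * n ≤ ρ.length) (sg : List Bool → List Bool) (x : List Bool) :
    𝒜.alg.runIdx (OFunI n pkN (Function.update sgN L₀ sg) ρ) (TA P 𝒜 n) x =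
        𝒜.alg.runIdx (OFunI n pkN (Function.update sgN L₀ fun _ => sg (mStar P 𝒜 n pkN sgN ρ L₀ x)) ρ) (TA P 𝒜 n) x ∧
      𝒜.alg.queriesIdx (OFunI n pkN (Function.update sgN L₀ sg) ρ) (TA P 𝒜 n) x =
        𝒜.alg.queriesIdx (OFunI n pkN (Function.update sgN L₀ fun _ => sg (mStar P 𝒜 n pkN sgN ρ L₀ x)) ρ) (TA P 𝒜 n) x := by
  rcases hL with hL | ⟨hL, hnc⟩
  · rw [mStar, if_pos hL]
    exact run_update_eq_of_short pkN sgN hL ρ hρ (sg' := fun _ => sg (pairMsg pkN L₀)) rfl x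
  · rw [mStar, if_neg (by omega)]
    exact run_update_eq_of_leaf pkN sgN hL ρ hρ hnc sg x

/-- The planted node is USED by the attack (against the signer `sgN'`, in practice the dummy): some query passes through
it. [folklore] -/
def Used (n : ℕ) (pkN : List Bool → List Bool) (sgN' : List Bool → List Bool → List Bool) (ρ L₀ x : List Bool) : Prop :=
  firstUse n (TA P 𝒜 n) ρ L₀ < (𝒜.alg.queriesIdx (OFunI n pkN sgN' ρ) (TA P 𝒜 n) x).length

/-- The transcripts against two signers at `L₀` agree up to and including round `firstUse`. [folklore] -/
theorem queriesIdx_take_firstUse_eq {n : ℕ} (pkN : List Bool → List Bool) (sgN : List Bool → List Bool → List Bool) (L₀ ρ : List Bool)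
    (s₁ s₂ : List Bool → List Bool) (x : List Bool) :
    (𝒜.alg.queriesIdx (OFunI n pkN (Function.update sgN L₀ s₁) ρ) (TA P 𝒜 n) x).take (firstUse n (TA P 𝒜 n) ρ L₀ + 1) =
      (𝒜.alg.queriesIdx (OFunI n pkN (Function.update sgN L₀ s₂) ρ) (TA P 𝒜 n) x).take (firstUse n (TA P 𝒜 n) ρ L₀ + 1) :=
  IdxRun.queriesIdx_take_congr 𝒜.alg _ x _ fun _ hi q =>
    sigGI_update_eq_of_not_prefix pkN sgN (take_blk_ne_of_lt_firstUse hi (lt_of_lt_of_le hi (firstUse_le _ _ ρ L₀))) s₁ s₂ q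

/-- `Used` does not depend on the signer at `L₀`. [folklore] -/
theorem used_iff {n : ℕ} (pkN : List Bool → List Bool) (sgN : List Bool → List Bool → List Bool) (L₀ ρ : List Bool)
    (s₁ s₂ : List Bool → List Bool) (x : List Bool) :
    Used (P := P) (𝒜 := 𝒜) n pkN (Function.update sgN L₀ s₁) ρ L₀ x ↔ Used (P := P) (𝒜 := 𝒜) n pkN (Function.update sgN L₀ s₂) ρ L₀ x := by
  unfold Used
  have h := congrArg List.length (queriesIdx_take_firstUse_eq (P := P) (𝒜 := 𝒜) (n := n) pkN sgN L₀ ρ s₁ s₂ x)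
  simp only [List.length_take] at h
  omega

/-- When used, the query through the planted node is the same against every signer at `L₀`. [folklore] -/
theorem getElem_firstUse_eq {n : ℕ} (pkN : List Bool → List Bool) (sgN : List Bool → List Bool → List Bool) (L₀ ρ : List Bool)
    (s₁ s₂ : List Bool → List Bool) (x : List Bool)
    (h₁ : firstUse n (TA P 𝒜 n) ρ L₀ < (𝒜.alg.queriesIdx (OFunI n pkN (Function.update sgN L₀ s₁) ρ) (TA P 𝒜 n) x).length)
    (h₂ : firstUse n (TA P 𝒜 n) ρ L₀ < (𝒜.alg.queriesIdx (OFunI n pkN (Function.update sgN L₀ s₂) ρ) (TA P 𝒜 n) x).length) :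
    (𝒜.alg.queriesIdx (OFunI n pkN (Function.update sgN L₀ s₁) ρ) (TA P 𝒜 n) x)[firstUse n (TA P 𝒜 n) ρ L₀] =
      (𝒜.alg.queriesIdx (OFunI n pkN (Function.update sgN L₀ s₂) ρ) (TA P 𝒜 n) x)[firstUse n (TA P 𝒜 n) ρ L₀] := by
  have h := queriesIdx_take_firstUse_eq (P := P) (𝒜 := 𝒜) (n := n) pkN sgN L₀ ρ s₁ s₂ x
  have e1 := List.getElem_take (xs := 𝒜.alg.queriesIdx (OFunI n pkN (Function.update sgN L₀ s₁) ρ) (TA P 𝒜 n) x)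
    (i := firstUse n (TA P 𝒜 n) ρ L₀) (j := firstUse n (TA P 𝒜 n) ρ L₀ + 1) (h := by rw [List.length_take]; omega)
  have e2 := List.getElem_take (xs := 𝒜.alg.queriesIdx (OFunI n pkN (Function.update sgN L₀ s₂) ρ) (TA P 𝒜 n) x)
    (i := firstUse n (TA P 𝒜 n) ρ L₀) (j := firstUse n (TA P 𝒜 n) ρ L₀ + 1) (h := by rw [List.length_take]; omega)
  rw [← e1, ← e2]
  exact List.getElem_of_eq h _

/-- **An unused planted node**: if no query passes through `L₀`, the attack does not depend on the signer at `L₀` at all.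
[Goldreich 2004, proof of Prop. 6.4.15, Step 3] [folklore] -/
theorem run_update_eq_of_not_used {n : ℕ} (pkN : List Bool → List Bool) (sgN : List Bool → List Bool → List Bool) {L₀ : List Bool} (ρ : List Bool)
    (s₁ s₂ : List Bool → List Bool) (x : List Bool)
    (hnu : ¬ Used (P := P) (𝒜 := 𝒜) n pkN (Function.update sgN L₀ s₁) ρ L₀ x) :
    𝒜.alg.runIdx (OFunI n pkN (Function.update sgN L₀ s₁) ρ) (TA P 𝒜 n) x = 𝒜.alg.runIdx (OFunI n pkN (Function.update sgN L₀ s₂) ρ) (TA P 𝒜 n) x ∧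
      𝒜.alg.queriesIdx (OFunI n pkN (Function.update sgN L₀ s₁) ρ) (TA P 𝒜 n) x =
        𝒜.alg.queriesIdx (OFunI n pkN (Function.update sgN L₀ s₂) ρ) (TA P 𝒜 n) x := by
  unfold Used at hnu
  refine IdxRun.runIdx_congr_on 𝒜.alg _ x fun i hi => ?_
  have hiU : i < firstUse n (TA P 𝒜 n) ρ L₀ := by omega
  have hiT : i < TA P 𝒜 n := lt_of_lt_of_le hi (OracleAlg.length_queriesIdx_le _ _ _ _)
  exact sigGI_update_eq_of_not_prefix pkN sgN (take_blk_ne_of_lt_firstUse hiU hiT) s₁ s₂ _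

end TreeSig

end Literature.Computability.Cryptography
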